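import Mathlib
import Literature.Probability.LatticeModels.LatticeGraph

/-!
# The log-convex continuum lift — real/complex arithmetic core
(crux `PauliWegnerSea.ChiralOneScaleTrajectory`, stmt-QuantumFields-17512, line `log-convex-continuum-lift`,
helpers for the registered stub `stub_pinOfLatticeLightness` of skeleton v2
`Cruxes/ChiralOneScaleTrajectory/Lines/log_convex_continuum_lift.lean`)

Pure bookkeeping lemmas, quantified over ABSTRACT data at one cutoff index `k`: a complex-valued function
`N` of the lattice site (standing for the un-normalised antiperiodic pion numerator `v ↦ N_AP(v)`), its
source-and-sink smearing `D T h n = Σ_{z,z'∈T} h z h z' N(n e₀ + z' − z)`, the periodic numerator on the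
time axis `NP`, the two partition functions `ZA`, `ZP`, and the transfer-positivity phase `u`; the finitely
many inequalities of the lift (RP–Hankel positivity (G1)–(G3), lightness, the polynomial floor, twist
insensitivity, the gap bound) are hypotheses.  Contents:

* `norm_le_two_mul_of_twist`, `norm_le_three_halves_of_twist`, `norm_smear_le`, `sub_site_spatial` — small
  norm / site facts;
* `chord_light_lower` — chord inequality + lightness + positive floor give `e n₂ ≤ e^{ε a (t − n₂)} e t`;
* `norm_smear_le` — `‖Σ_{z,z'} h z h z' F z z'‖ ≤ (Σ|h|)² · M`;
* `logscale_time` — the integer log-scale time `t = ⌈K|log a|/(2a)⌉` fits in the box `S = L_k`;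
* `final_real` — the closing real-arithmetic contradiction `(C/3) a⁻¹ ≤ C' < (C/3) a⁻¹`;
* `stub_pinOfLatticeLightness_core` — everything assembled at one cutoff index (registered sub-goal of the stub).

Folklore real analysis; no physics and no lattice objects beyond `Site 4 = Fin 4 → ℤ`.
-/

namespace Summit.QuantumFields.QCD.Cruxes.ChiralOneScaleTrajectory.LogConvexLift.Lift

open scoped BigOperators ComplexOrder
open Literature.Probability.LatticeModels

/-! ### Small complex-norm facts -/

/-- Twist insensitivity `2‖x − y‖ ≤ ‖x‖` gives `‖x‖ ≤ 2‖y‖`. [folklore] -/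
theorem norm_le_two_mul_of_twist {x y : ℂ} (h : 2 * ‖x - y‖ ≤ ‖x‖) : ‖x‖ ≤ 2 * ‖y‖ := by
  have := norm_sub_norm_le x y
  linarith

/-- Twist insensitivity `2‖x − y‖ ≤ ‖x‖` gives `‖y‖ ≤ (3/2)‖x‖`. [folklore] -/
theorem norm_le_three_halves_of_twist {x y : ℂ} (h : 2 * ‖x - y‖ ≤ ‖x‖) : ‖y‖ ≤ 3 / 2 * ‖x‖ := by
  have := norm_sub_norm_le y x
  rw [norm_sub_rev] at this
  linarith

/-- **Smearing bound**: a double `h ⊗ h`-smeared sum of terms bounded by `M` in norm is bounded by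
`(Σ|h|)² M`. [folklore] -/
theorem norm_smear_le {T : Finset (Site 4)} {h : Site 4 → ℝ} {F : Site 4 → Site 4 → ℂ} {M : ℝ}
    (hM : ∀ z ∈ T, ∀ z' ∈ T, ‖F z z'‖ ≤ M) :
    ‖∑ z ∈ T, ∑ z' ∈ T, ((h z * h z' : ℝ) : ℂ) * F z z'‖ ≤ (∑ z ∈ T, |h z|) ^ 2 * M := by
  calc ‖∑ z ∈ T, ∑ z' ∈ T, ((h z * h z' : ℝ) : ℂ) * F z z'‖
      ≤ ∑ z ∈ T, ‖∑ z' ∈ T, ((h z * h z' : ℝ) : ℂ) * F z z'‖ := norm_sum_le _ _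
    _ ≤ ∑ z ∈ T, ∑ z' ∈ T, |h z| * |h z'| * M := by
        refine Finset.sum_le_sum fun z hz => (norm_sum_le _ _).trans (Finset.sum_le_sum fun z' hz' => ?_)
        rw [norm_mul, Complex.norm_real, Real.norm_eq_abs, abs_mul]
        exact mul_le_mul_of_nonneg_left (hM z hz z' hz') (by positivity)
    _ = (∑ z ∈ T, |h z|) ^ 2 * M := by
        rw [sq, Finset.sum_mul_sum, Finset.sum_mul]
        refine Finset.sum_congr rfl fun z _ => ?_
        rw [Finset.sum_mul]

/-- Differences of spatial sites of sup-norm `≤ n₂` are spatial and of sup-norm `≤ 2n₂ ≤ S`. [folklore] -/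
theorem sub_site_spatial {T : Finset (Site 4)} {n₂ S : ℕ}
    (hT : ∀ z ∈ T, z 0 = 0 ∧ ∀ i, |z i| ≤ (n₂ : ℤ)) (h2 : 2 * n₂ ≤ S)
    {z z' : Site 4} (hz : z ∈ T) (hz' : z' ∈ T) :
    (z' - z) 0 = 0 ∧ ∀ i, |(z' - z) i| ≤ (S : ℤ) := by
  refine ⟨by rw [Pi.sub_apply, (hT z hz).1, (hT z' hz').1, sub_zero], fun i => ?_⟩
  rw [Pi.sub_apply]
  calc |z' i - z i| ≤ |z' i| + |z i| := abs_sub _ _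
    _ ≤ n₂ + n₂ := add_le_add ((hT z' hz').2 i) ((hT z hz).2 i)
    _ ≤ S := by exact_mod_cast (by omega : n₂ + n₂ ≤ S)

/-! ### The chord step -/

/-- **Chord + lightness + positive floor ⇒ lower bound far out.**  For a sequence `e ≥ 0` on `[1, N]`
that is locally log-convex on `[2, N−1]`, the three-point chord inequality (hypothesis `hchord`, the
`CHORD` stub of the line) at `n₁ < n₂ < t`, the lightness bound `e n₁ ≤ e n₂ · e^{ε a (n₂ − n₁)}` and
`e n₂ > 0` give `e n₂ ≤ e^{ε a (t − n₂)} · e t`: a log-convex sequence cannot decay faster further out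
than it does between `n₁` and `n₂`. [folklore] -/
theorem chord_light_lower
    (hchord : ∀ (e : ℕ → ℝ) (N : ℕ), (∀ j, 1 ≤ j → j ≤ N → 0 ≤ e j) →
      (∀ j, 2 ≤ j → j + 1 ≤ N → e j ^ 2 ≤ e (j - 1) * e (j + 1)) →
      ∀ i j k : ℕ, 1 ≤ i → i < j → j < k → k ≤ N → e j ^ (k - i) ≤ e i ^ (k - j) * e k ^ (j - i))
    {e : ℕ → ℝ} {N n₁ n₂ t : ℕ} {ε a : ℝ}
    (he : ∀ j, 1 ≤ j → j ≤ N → 0 ≤ e j)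
    (hlc : ∀ j, 2 ≤ j → j + 1 ≤ N → e j ^ 2 ≤ e (j - 1) * e (j + 1))
    (hn₁ : 1 ≤ n₁) (hn₁₂ : n₁ < n₂) (hn₂t : n₂ < t) (htN : t ≤ N)
    (hpos : 0 < e n₂) (hlight : e n₁ ≤ e n₂ * Real.exp (ε * (a * ((n₂ : ℝ) - n₁)))) :
    e n₂ ≤ Real.exp (ε * (a * ((t : ℝ) - n₂))) * e t := by
  have hch := hchord e N he hlc n₁ n₂ t hn₁ hn₁₂ hn₂t htN
  have hen₁ : 0 ≤ e n₁ := he n₁ hn₁ (by omega)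
  have het : 0 ≤ e t := he t (by omega) htN
  have hexp : Real.exp (ε * (a * ((n₂ : ℝ) - n₁))) ^ (t - n₂) =
      Real.exp (ε * (a * ((t : ℝ) - n₂))) ^ (n₂ - n₁) := by
    rw [← Real.exp_nat_mul, ← Real.exp_nat_mul, Nat.cast_sub hn₂t.le, Nat.cast_sub hn₁₂.le]
    congr 1
    ring
  have h1 : e n₁ ^ (t - n₂) ≤ (e n₂ * Real.exp (ε * (a * ((n₂ : ℝ) - n₁)))) ^ (t - n₂) :=
    pow_le_pow_left₀ hen₁ hlight _
  have h2 := hch.trans (mul_le_mul_of_nonneg_right h1 (pow_nonneg het (n₂ - n₁)))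
  rw [show t - n₁ = (t - n₂) + (n₂ - n₁) from by omega, pow_add, mul_pow, mul_assoc, hexp,
    ← mul_pow] at h2
  exact (pow_le_pow_iff_left₀ hpos.le (mul_nonneg (Real.exp_pos _).le het) (by omega)).1
    (le_of_mul_le_mul_left h2 (pow_pos hpos _))

/-! ### The log-scale time -/

/-- **The log-scale time fits.**  With `0 < a ≤ 1/2`, `K > 0`, `n₂ a ≤ R`, `a < e^{−2R/K}` and the
volume condition `max(2R, K+2) ≤ a S / (1 + |log a|)`, the integer `t := ⌈K |log a| / (2a)⌉` satisfies
`n₂ < t`, `2t ≤ S`, `2n₂ ≤ S`, `2t · a ≤ (K+2)(1+|log a|)` and `a t ≥ K|log a|/2`. [folklore] -/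
theorem logscale_time {a K R : ℝ} {S n₂ : ℕ} (ha : 0 < a) (ha1 : a ≤ 1 / 2) (hK : 0 < K)
    (hn₂ : 1 ≤ n₂) (hn₂R : (n₂ : ℝ) * a ≤ R) (ha3 : a < Real.exp (-(2 * R / K)))
    (hL : max (2 * R) (K + 2) ≤ a * S / (1 + |Real.log a|)) :
    n₂ < ⌈K * |Real.log a| / (2 * a)⌉₊ ∧ 2 * ⌈K * |Real.log a| / (2 * a)⌉₊ ≤ S ∧ 2 * n₂ ≤ S ∧
      ((2 * ⌈K * |Real.log a| / (2 * a)⌉₊ : ℕ) : ℝ) * a ≤ (K + 2) * (1 + |Real.log a|) ∧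
      K * |Real.log a| / 2 ≤ a * ⌈K * |Real.log a| / (2 * a)⌉₊ := by
  have hlog : Real.log a < 0 := Real.log_neg ha (by linarith)
  have hℓ0 : 0 < |Real.log a| := abs_pos.2 hlog.ne
  have h1ℓ : 0 < 1 + |Real.log a| := by positivity
  rw [le_div_iff₀ h1ℓ] at hL
  have hKS : (K + 2) * (1 + |Real.log a|) ≤ a * S :=
    (mul_le_mul_of_nonneg_right (le_max_right _ _) h1ℓ.le).trans hL
  have hRS : 2 * R * (1 + |Real.log a|) ≤ a * S :=
    (mul_le_mul_of_nonneg_right (le_max_left _ _) h1ℓ.le).trans hL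
  have hn₂pos : (0 : ℝ) < n₂ := Nat.cast_pos.2 hn₂
  have hR : 0 < R := lt_of_lt_of_le (mul_pos hn₂pos ha) hn₂R
  have hRℓ : 0 ≤ 2 * R * |Real.log a| := by positivity
  have h2R : 2 * R ≤ a * S := by nlinarith
  -- `R < K |log a| / 2` from `a < e^{-2R/K}`
  have hRl : R < K * |Real.log a| / 2 := by
    have h := Real.log_lt_log ha ha3
    rw [Real.log_exp] at h
    rw [abs_of_neg hlog]
    have : 2 * R / K < -Real.log a := by linarith
    rw [div_lt_iff₀ hK] at this
    linarith
  -- the ceiling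
  have hq0 : 0 ≤ K * |Real.log a| / (2 * a) := by positivity
  have ht1 : K * |Real.log a| / (2 * a) ≤ (⌈K * |Real.log a| / (2 * a)⌉₊ : ℝ) := Nat.le_ceil _
  have ht2 : (⌈K * |Real.log a| / (2 * a)⌉₊ : ℝ) < K * |Real.log a| / (2 * a) + 1 :=
    Nat.ceil_lt_add_one hq0
  generalize ⌈K * |Real.log a| / (2 * a)⌉₊ = t at ht1 ht2 ⊢
  have haq : a * (K * |Real.log a| / (2 * a)) = K * |Real.log a| / 2 := by
    field_simp
  have hat : K * |Real.log a| / 2 ≤ a * t := by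
    rw [← haq]
    exact mul_le_mul_of_nonneg_left ht1 ha.le
  have h2ta : ((2 * t : ℕ) : ℝ) * a ≤ (K + 2) * (1 + |Real.log a|) := by
    push_cast
    have : (2 * (t : ℝ)) * a < K * |Real.log a| + 2 * a := by
      have := mul_lt_mul_of_pos_left ht2 ha
      rw [mul_add, haq, mul_one] at this
      linarith
    nlinarith
  refine ⟨?_, ?_, ?_, h2ta, hat⟩
  · have : (n₂ : ℝ) < t := by
      have h1 : (n₂ : ℝ) * a < a * (K * |Real.log a| / (2 * a)) := by rw [haq]; linarith
      have h2 : (n₂ : ℝ) < K * |Real.log a| / (2 * a) := by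
        rw [mul_comm] at h1
        exact lt_of_mul_lt_mul_left h1 ha.le
      linarith
    exact_mod_cast this
  · have : ((2 * t : ℕ) : ℝ) ≤ S := by
      have h := h2ta.trans hKS
      rw [mul_comm] at h
      exact le_of_mul_le_mul_left h ha
    exact_mod_cast this
  · have : ((2 * n₂ : ℕ) : ℝ) ≤ S := by
      push_cast
      have h : (2 * (n₂ : ℝ)) * a ≤ a * S := by linarith
      rw [mul_comm] at h
      exact le_of_mul_le_mul_left h ha
    exact_mod_cast this

/-! ### The closing real arithmetic -/

/-- **The closing contradiction.**  Floor `C a^p H² za ≤ E₂`, chord step `E₂ ≤ e^{εa(t−n₂)} Et`,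
smearing `Et ≤ H² na`, twist `na ≤ 2 np`, `zp ≤ (3/2) za`, gap `np / zp ≤ C' e^{−2εat}`, the log-scale
`a t ≥ K|log a|/2` with `εK = 2(p+1)`, and the cutoff condition `C' a < C/3` are incompatible
(`a ≤ 1/2`): they force `C a⁻¹ ≤ 3 C'`. [folklore] -/
theorem final_real {ε a K C C' E₂ Et H za na np zp : ℝ} {p n₂ t : ℕ}
    (hε : 0 < ε) (ha : 0 < a) (ha1 : a ≤ 1 / 2) (hC : 0 < C) (hKε : ε * K = 2 * (p + 1))
    (hH : 0 < H) (hza : 0 < za)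
    (hfloor : C * a ^ p * (H ^ 2 * za) ≤ E₂)
    (hA : E₂ ≤ Real.exp (ε * (a * ((t : ℝ) - n₂))) * Et)
    (hsm : Et ≤ H ^ 2 * na) (hna : na ≤ 2 * np)
    (hzp : zp ≤ 3 / 2 * za) (hzp0 : 0 < zp)
    (hgap : np / zp ≤ C' * Real.exp (-(ε * (a * (2 * (t : ℝ))))))
    (hat : K * |Real.log a| / 2 ≤ a * t) (ha2 : C' * a < C / 3) : False := by
  have hlog : Real.log a < 0 := Real.log_neg ha (by linarith)
  have hℓ : |Real.log a| = -Real.log a := abs_of_neg hlog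
  have hX : 0 < Real.exp (ε * (a * ((t : ℝ) - n₂))) := Real.exp_pos _
  have he2 : 0 < Real.exp (-(ε * (a * (2 * (t : ℝ))))) := Real.exp_pos _
  have hH2 : 0 < H ^ 2 := by positivity
  -- the chain up to `np`
  have h1 : C * a ^ p * (H ^ 2 * za) ≤ Real.exp (ε * (a * ((t : ℝ) - n₂))) * (H ^ 2 * (2 * np)) :=
    hfloor.trans (hA.trans (mul_le_mul_of_nonneg_left
      (hsm.trans (mul_le_mul_of_nonneg_left hna hH2.le)) hX.le))
  have hlhs : 0 < C * a ^ p * (H ^ 2 * za) := mul_pos (mul_pos hC (pow_pos ha p)) (mul_pos hH2 hza)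
  have hnp : 0 < np := by
    by_contra hcon
    push Not at hcon
    have : Real.exp (ε * (a * ((t : ℝ) - n₂))) * (H ^ 2 * (2 * np)) ≤ 0 :=
      mul_nonpos_of_nonneg_of_nonpos hX.le (mul_nonpos_of_nonneg_of_nonpos hH2.le (by linarith))
    linarith
  rw [div_le_iff₀ hzp0] at hgap
  have hC'0 : 0 ≤ C' := by
    by_contra hcon
    push Not at hcon
    have : C' * Real.exp (-(ε * (a * (2 * (t : ℝ))))) * zp < 0 :=
      mul_neg_of_neg_of_pos (mul_neg_of_neg_of_pos hcon he2) hzp0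
    linarith
  have h2 : np ≤ C' * Real.exp (-(ε * (a * (2 * (t : ℝ))))) * (3 / 2 * za) :=
    hgap.trans (mul_le_mul_of_nonneg_left hzp (mul_nonneg hC'0 he2.le))
  -- combine and cancel `H² za`
  have h3 : C * a ^ p * (H ^ 2 * za) ≤
      (3 * C' * (Real.exp (ε * (a * ((t : ℝ) - n₂))) * Real.exp (-(ε * (a * (2 * (t : ℝ))))))) *
        (H ^ 2 * za) := by
    have := h1.trans (mul_le_mul_of_nonneg_left (mul_le_mul_of_nonneg_left
      (mul_le_mul_of_nonneg_left h2 (by norm_num : (0 : ℝ) ≤ 2)) hH2.le) hX.le)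
    refine this.trans (le_of_eq ?_)
    ring
  have h4 : C * a ^ p ≤
      3 * C' * (Real.exp (ε * (a * ((t : ℝ) - n₂))) * Real.exp (-(ε * (a * (2 * (t : ℝ)))))) :=
    le_of_mul_le_mul_right h3 (mul_pos hH2 hza)
  -- exponent bookkeeping
  have h5 : Real.exp (ε * (a * ((t : ℝ) - n₂))) * Real.exp (-(ε * (a * (2 * (t : ℝ))))) ≤
      Real.exp (-(ε * (a * t))) := by
    rw [← Real.exp_add]
    refine Real.exp_le_exp.2 ?_
    have h0 : 0 ≤ ε * (a * (n₂ : ℝ)) := mul_nonneg hε.le (mul_nonneg ha.le (Nat.cast_nonneg _))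
    have : ε * (a * ((t : ℝ) - n₂)) + -(ε * (a * (2 * (t : ℝ)))) = -(ε * (a * t)) - ε * (a * n₂) := by
      ring
    rw [this]
    linarith
  have h6 : (a⁻¹) ^ (p + 1) ≤ Real.exp (ε * (a * t)) := by
    have : (a⁻¹) ^ (p + 1) = Real.exp (((p + 1 : ℕ) : ℝ) * (-Real.log a)) := by
      rw [Real.exp_nat_mul, Real.exp_neg, Real.exp_log ha]
    rw [this]
    refine Real.exp_le_exp.2 ?_
    have h7 : ((p + 1 : ℕ) : ℝ) * (-Real.log a) = ε * (K * |Real.log a| / 2) := by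
      rw [hℓ, show ((p + 1 : ℕ) : ℝ) = ε * K / 2 by push_cast; linarith]
      ring
    rw [h7]
    exact mul_le_mul_of_nonneg_left hat hε.le
  have h8 : C * a ^ p * Real.exp (ε * (a * t)) ≤ 3 * C' := by
    have := h4.trans (mul_le_mul_of_nonneg_left h5 (by positivity))
    have hprod : Real.exp (-(ε * (a * t))) * Real.exp (ε * (a * t)) = 1 := by
      rw [← Real.exp_add, neg_add_cancel, Real.exp_zero]
    calc C * a ^ p * Real.exp (ε * (a * t))
        ≤ 3 * C' * Real.exp (-(ε * (a * t))) * Real.exp (ε * (a * t)) :=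
          mul_le_mul_of_nonneg_right this (Real.exp_pos _).le
      _ = 3 * C' := by rw [mul_assoc, hprod, mul_one]
  have h9 : C * a⁻¹ ≤ 3 * C' := by
    have hpow : a ^ p * (a⁻¹) ^ (p + 1) = a⁻¹ := by
      rw [pow_succ, ← mul_assoc, ← mul_pow, mul_inv_cancel₀ ha.ne', one_pow, one_mul]
    calc C * a⁻¹ = C * a ^ p * (a⁻¹) ^ (p + 1) := by rw [mul_assoc, hpow]
      _ ≤ C * a ^ p * Real.exp (ε * (a * t)) :=
          mul_le_mul_of_nonneg_left h6 (mul_nonneg hC.le (pow_nonneg ha.le p))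
      _ ≤ 3 * C' := h8
  rw [mul_inv_le_iff₀ ha] at h9
  linarith

/-! ### Assembly at one cutoff index -/

/-- **The lift at one cutoff index.**  At a cutoff index `k` (spacing `a`, box `S = L_k`) carrying the
light witness data (`T, h, n₁ < n₂`, floor and lightness at even times), the RP–Hankel positivity phase
`u` with (G1)–(G3), twist insensitivity with constant `K + 2`, the uniform gap bound with rate `ε` on the
charged pion pair (`‖N_P(n e₀)/Z_P‖ ≤ C' e^{−ε a n}`, `n ≤ S`), and the four cutoff conditions
`a ≤ 1/2`, `C' a < C/3`, `a < e^{−2R/K}`, `max(2R, K+2) ≤ a S/(1+|log a|)`, one reaches `False`: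
`E_j := ‖D(2j)‖ = Re(u D(2j))` is locally log-convex by (G1)–(G2); the chord step at the log-scale time
`t = ⌈K|log a|/(2a)⌉` and (G3) bound `‖N_AP(2t e₀)‖` below by `C a^p ‖Z_AP‖ e^{−εat}`; the twist turns
this into `‖N_P/Z_P‖ ≥ (C/3) a^p e^{−εat}`, and the gap `≤ C' e^{−2εat}` with `e^{εat} ≥ a^{−(p+1)}`
gives `(C/3) a⁻¹ ≤ C'`. [folklore] -/
theorem stub_pinOfLatticeLightness_core :
    ∀ {ε a K R C C' : ℝ} {p S n₁ n₂ : ℕ} {T : Finset (Literature.Probability.LatticeModels.Site 4)}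
      {h : Literature.Probability.LatticeModels.Site 4 → ℝ} {N : Literature.Probability.LatticeModels.Site 4 → ℂ}
      {D : Finset (Literature.Probability.LatticeModels.Site 4) → (Literature.Probability.LatticeModels.Site 4 → ℝ) → ℕ → ℂ}
      {NP : ℕ → ℂ} {ZA ZP u : ℂ},
      (∀ (e : ℕ → ℝ) (N : ℕ), (∀ j, 1 ≤ j → j ≤ N → 0 ≤ e j) →
        (∀ j, 2 ≤ j → j + 1 ≤ N → e j ^ 2 ≤ e (j - 1) * e (j + 1)) →
        ∀ i j k : ℕ, 1 ≤ i → i < j → j < k → k ≤ N → e j ^ (k - i) ≤ e i ^ (k - j) * e k ^ (j - i)) →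
      (∀ (T' : Finset (Literature.Probability.LatticeModels.Site 4)) (h' : Literature.Probability.LatticeModels.Site 4 → ℝ) (n : ℕ),
        D T' h' n = ∑ z ∈ T', ∑ z' ∈ T', ((h' z * h' z' : ℝ) : ℂ) *
          N (Pi.single (0 : Fin 4) ((n : ℕ) : ℤ) + (z' - z))) →
      0 < ε → 0 < a → 0 < C → 0 < K → ε * K = 2 * (p + 1) →
      1 ≤ n₁ → n₁ < n₂ → (n₂ : ℝ) * a ≤ R →
      (∀ z ∈ T, z 0 = 0 ∧ ∀ i, |z i| ≤ (n₂ : ℤ)) →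
      0 < ∑ z ∈ T, |h z| → 0 < ‖ZA‖ →
      C * a ^ p * ((∑ z ∈ T, |h z|) ^ 2 * ‖ZA‖) ≤ ‖D T h (2 * n₂)‖ →
      ‖D T h (2 * n₁)‖ ≤ ‖D T h (2 * n₂)‖ * Real.exp (ε * (a * ((n₂ : ℝ) - n₁))) →
      ‖u‖ = 1 →
      (∀ (T' : Finset (Literature.Probability.LatticeModels.Site 4)) (h' : Literature.Probability.LatticeModels.Site 4 → ℝ),
        (∀ z ∈ T', z 0 = 0 ∧ ∀ i, |z i| ≤ (S : ℤ)) →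
        ∀ s t : ℕ, 1 ≤ s → s ≤ S → 1 ≤ t → t ≤ S →
          0 ≤ u * D T' h' (2 * s) ∧
            ‖D T' h' (s + t)‖ ^ 2 ≤ (u * D T' h' (2 * s)).re * (u * D T' h' (2 * t)).re) →
      (∀ (t : ℕ) (w : Literature.Probability.LatticeModels.Site 4), 1 ≤ t → t ≤ S → w 0 = 0 →
        (∀ i, |w i| ≤ (S : ℤ)) →
          ‖N (Pi.single (0 : Fin 4) (((2 * t : ℕ) : ℤ)) + w)‖ ≤
            (u * N (Pi.single (0 : Fin 4) (((2 * t : ℕ) : ℤ)))).re) →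
      2 * ‖ZA - ZP‖ ≤ ‖ZA‖ →
      (∀ n : ℕ, (n : ℝ) * a ≤ (K + 2) * (1 + |Real.log a|) →
        2 * ‖N (Pi.single (0 : Fin 4) ((n : ℕ) : ℤ)) - NP n‖ ≤ ‖N (Pi.single (0 : Fin 4) ((n : ℕ) : ℤ))‖) →
      (∀ n : ℕ, n ≤ S → ‖NP n / ZP‖ ≤ C' * Real.exp (-(ε * (a * n)))) →
      a ≤ 1 / 2 → C' * a < C / 3 → a < Real.exp (-(2 * R / K)) →
      max (2 * R) (K + 2) ≤ a * S / (1 + |Real.log a|) → False := by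
  intro ε a K R C C' p S n₁ n₂ T h N D NP ZA ZP u hchord hD hε ha hC hK hKε hn₁ hn₁₂ hn₂R hT hH hZA hfloor
    hlight hu hG12 hG3 htwZ htwN hgap ha1 ha2 ha3 hL
  -- the log-scale time `t`
  obtain ⟨hn₂t, h2tS, h2n₂S, htwt, hat⟩ := logscale_time ha ha1 hK (by omega) hn₂R ha3 hL
  generalize ⌈K * |Real.log a| / (2 * a)⌉₊ = t at hn₂t h2tS htwt hat
  have htS : t ≤ S := by omega
  have hn₂S : n₂ ≤ S := by omega
  have h1t : 1 ≤ t := by omega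
  -- the light profile is supported in the box of radius `S`
  have hTS : ∀ z ∈ T, z 0 = 0 ∧ ∀ i, |z i| ≤ (S : ℤ) := fun z hz =>
    ⟨(hT z hz).1, fun i => ((hT z hz).2 i).trans (by exact_mod_cast hn₂S)⟩
  -- (G1): `‖D(2j)‖ = Re(u D(2j))` for `1 ≤ j ≤ S`
  have hre : ∀ j, 1 ≤ j → j ≤ S → ‖D T h (2 * j)‖ = (u * D T h (2 * j)).re := fun j hj hjS => by
    -- `0 ≤ w` in `ℂ` gives `‖w‖ = Re w` (tree: `Literature.NumberTheory.LFunctions.norm_eq_re_of_complex_nonneg`)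
    have h0 := congrArg Complex.re (Complex.norm_of_nonneg' (hG12 T h hTS j j hj hjS hj hjS).1)
    rw [Complex.ofReal_re] at h0
    rw [← h0, norm_mul, hu, one_mul]
  -- (G2): local log-convexity of `j ↦ ‖D(2j)‖`
  have hlc : ∀ j, 2 ≤ j → j + 1 ≤ S →
      ‖D T h (2 * j)‖ ^ 2 ≤ ‖D T h (2 * (j - 1))‖ * ‖D T h (2 * (j + 1))‖ := by
    intro j hj hjS
    have h2 := (hG12 T h hTS (j - 1) (j + 1) (by omega) (by omega) (by omega) hjS).2
    rw [show j - 1 + (j + 1) = 2 * j from by omega] at h2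
    rwa [hre (j - 1) (by omega) (by omega), hre (j + 1) (by omega) hjS]
  -- chord + lightness + floor
  have hpos : 0 < ‖D T h (2 * n₂)‖ :=
    lt_of_lt_of_le (mul_pos (mul_pos hC (pow_pos ha p)) (mul_pos (pow_pos hH 2) hZA)) hfloor
  have hA : ‖D T h (2 * n₂)‖ ≤ Real.exp (ε * (a * ((t : ℝ) - n₂))) * ‖D T h (2 * t)‖ :=
    chord_light_lower hchord (e := fun j => ‖D T h (2 * j)‖) (N := S)
      (fun j _ _ => norm_nonneg _) hlc hn₁ hn₁₂ hn₂t htS hpos hlight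
  -- (G3): smearing bound at time `2t`
  have hsm : ‖D T h (2 * t)‖ ≤
      (∑ z ∈ T, |h z|) ^ 2 * ‖N (Pi.single (0 : Fin 4) (((2 * t : ℕ) : ℤ)))‖ := by
    have hM : ∀ z ∈ T, ∀ z' ∈ T,
        ‖N (Pi.single (0 : Fin 4) (((2 * t : ℕ) : ℤ)) + (z' - z))‖ ≤
          (u * N (Pi.single (0 : Fin 4) (((2 * t : ℕ) : ℤ)))).re := fun z hz z' hz' => by
      obtain ⟨hw0, hwS⟩ := sub_site_spatial hT h2n₂S hz hz'
      exact hG3 t (z' - z) h1t htS hw0 hwS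
    have hMle : (u * N (Pi.single (0 : Fin 4) (((2 * t : ℕ) : ℤ)))).re ≤
        ‖N (Pi.single (0 : Fin 4) (((2 * t : ℕ) : ℤ)))‖ := by
      refine (Complex.re_le_norm _).trans_eq ?_
      rw [norm_mul, hu, one_mul]
    rw [hD]
    -- all implicit data are given explicitly: unassigned metavariables inside the big sums make
    -- unification expensive
    have X := norm_smear_le (h := h)
      (F := fun z z' => N (Pi.single (0 : Fin 4) (((2 * t : ℕ) : ℤ)) + (z' - z))) hM
    have Y : (∑ z ∈ T, |h z|) ^ 2 * (u * N (Pi.single (0 : Fin 4) (((2 * t : ℕ) : ℤ)))).re ≤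
        (∑ z ∈ T, |h z|) ^ 2 * ‖N (Pi.single (0 : Fin 4) (((2 * t : ℕ) : ℤ)))‖ :=
      mul_le_mul_of_nonneg_left hMle (sq_nonneg _)
    exact X.trans Y
  -- twist insensitivity and the gap at `n = 2t`
  have hna := norm_le_two_mul_of_twist (htwN (2 * t) htwt)
  have hzp := norm_le_three_halves_of_twist htwZ
  have hzp0 : 0 < ‖ZP‖ := by
    have := norm_le_two_mul_of_twist htwZ
    linarith
  have hgap' := hgap (2 * t) h2tS
  rw [norm_div] at hgap'
  push_cast at hgap'
  exact final_real hε ha ha1 hC hKε hH hZA hfloor hA hsm hna hzp hzp0 hgap' hat ha2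

end Summit.QuantumFields.QCD.Cruxes.ChiralOneScaleTrajectory.LogConvexLift.Lift
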